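import Literature.AlgebraicGeometry.Motives.RealWeilDatumPeriodDomain
import Literature.AlgebraicGeometry.Motives.WeilTypePeriodDomainHomeomorph
import HarnessLib

/-!
# Deligne's real period domain is a ball: `posComplexStructures k ψ ≃ₜ X⁺(H₀) ≃ₜ I_{p,q}`

Layer `Literature/AlgebraicGeometry/Motives`, namespace `Literature.AlgebraicGeometry.Motives.RealWeilDatum`; lane
`lit-hodgefound` (Track 2 foundations library), Layer A (period domain of abelian varieties of Weil type; prover
seat p13, generation 8, FILE 8 of the self-proposed row «van Geemen 1994 Lemma 5.10»). Sequel of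
`Motives/RealWeilDatumPeriodDomain` (FILE 6: for a real Weil datum `D = (V, k, ψ)` the SET-THEORETIC dictionary
`posComplexStructuresEquiv : posComplexStructures k ψ ≃ WeilComplexStructures D.hForm` with the Hermitian `X⁺` of
`((V, i), H = ψ(·, i·) + iψ)`) and of `Motives/WeilTypePeriodDomainHomeomorph` (FILE 7: the standard model
`unitaryPeriodDomainHomeomorph : I_{p,q} ≃ₜ X⁺(H₀)`). Here the dictionary is made TOPOLOGICAL: in a unitary
frame `F : ((V, i), H) ≅ (ℂᵖ × ℂ^q, H₀)` the map `J ↦ F J F⁻¹` is a homeomorphism of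
`posComplexStructures k ψ ⊂ End_ℝ(V)` (operator-norm topology, the one used by
`QuadraticForm/PosComplexStructuresConnected/Contractible/ArithmeticQuotient`) onto `X⁺(H₀) ⊂ End_ℂ(ℂᵖ × ℂ^q)`,
whence **`posComplexStructures k ψ ≃ₜ unitaryPeriodDomain p q`**, an open ball in `Hom(ℂᵖ, ℂ^q) ≅ ℂ^{pq}` —
Deligne's "`X⁺` … is an open connected complex submanifold" (LNM 900, p. 49) and the identification "with
`U(n, n)/U(n) × U(n)`" recorded as "Deliberately NOT here" in `PosComplexStructuresConnected`, in the topological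
category (the complex structure is not formalised).

Continuity is elementary: `J ↦ F_ℝ ∘ J ∘ F_ℝ⁻¹` is continuous linear on `End_ℝ(V)` (`realConj`), it is the
restriction of scalars of the `ℂ`-linear conjugate (`restrictScalars_stdEnd`), and restriction of scalars
`End_ℂ → End_ℝ` is an isometric embedding; the inverse `J' ↦ F_ℝ⁻¹ ∘ J' ∘ F_ℝ` is continuous likewise.

## What is here (no named fact; definitions are explicit maps with bodies; net debt 0)

* `frameℝ F : V ≃L[ℝ] ℂᵖ × ℂ^q`, `realConj`, `stdEnd` (+ `restrictScalars_stdEnd`, `stdEnd_mem_stdWeilDomain`),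
  `ofStd` (+ `ofStd_mem_posComplexStructures`);
* **`posComplexStructuresHomeomorphStd F : posComplexStructures k ψ ≃ₜ stdWeilDomain p q`**;
* **`posComplexStructuresHomeomorph F : posComplexStructures k ψ ≃ₜ unitaryPeriodDomain p q`**,
  `posComplexStructuresHomeomorphBall F : … ≃ₜ Metric.ball 0 1`;
* frame-free, for `ψ` non-degenerate: **`exists_homeomorph_unitaryPeriodDomain`**
  (`∃ p q, p + q = dim_ℂ (V, i) ∧ Nonempty (posComplexStructures k ψ ≃ₜ unitaryPeriodDomain p q)`).

## References

* [Deligne1982HodgeCycles] P. Deligne, LNM 900 (1982), proof of Thm. 4.8, p. 49.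
* [CarlsonMullerStachPeters2017] J. Carlson, S. Müller-Stach, C. Peters, *Period Mappings and Period Domains*,
  2nd ed., Thm. 16.1.5 (type AIII).
* [vanGeemen1994HodgeAV] B. van Geemen, LNM 1594 (1994), 5.5–5.10.
* [GohbergLancasterRodman2005] I. Gohberg, P. Lancaster, L. Rodman (2005), §10.1 (angular operator).
-/

noncomputable section

open Module
open Literature.LinearAlgebra.QuadraticForm
open Literature.Geometry.Kaehler

namespace Literature.AlgebraicGeometry.Motives

namespace RealWeilDatum

universe u

variable {V : Type u} [NormedAddCommGroup V] [NormedSpace ℝ V] (D : RealWeilDatum V)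
  {p q : ℕ} (F : UnitaryFrame D.hForm p q)

/-! ### The `ℂ`-linear conjugate `F J F⁻¹ ∈ X⁺(H₀)` of a point of `X⁺` -/

/-- For a `k`-linear `J`, the bounded `ℂ`-linear operator `F J F⁻¹` on `ℂᵖ × ℂ^q`.
[cite: Deligne1982HodgeCycles, proof of Thm. 4.8, p. 49] [cite: vanGeemen1994HodgeAV, 5.5] -/
def stdEnd (J : V →L[ℝ] V) (hJ : Commute J D.k) :
    (EuclideanSpace ℂ (Fin p) × EuclideanSpace ℂ (Fin q)) →L[ℂ] (EuclideanSpace ℂ (Fin p) × EuclideanSpace ℂ (Fin q)) :=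
  LinearMap.toContinuousLinearMap (F.toLinearEquiv.conj (D.cxEnd J hJ))

/-- `(stdEnd F J : _ →ₗ[ℂ] _) = F.conj (cxEnd J)`. [cite: vanGeemen1994HodgeAV, 5.5] -/
@[simp] theorem coe_stdEnd (J : V →L[ℝ] V) (hJ : Commute J D.k) :
    (D.stdEnd F J hJ : _ →ₗ[ℂ] _) = F.toLinearEquiv.conj (D.cxEnd J hJ) := rfl

/-- `stdEnd F J x = F (J (F⁻¹ x))`. [cite: vanGeemen1994HodgeAV, 5.5] -/
theorem stdEnd_apply (J : V →L[ℝ] V) (hJ : Commute J D.k) (x : EuclideanSpace ℂ (Fin p) × EuclideanSpace ℂ (Fin q)) :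
    D.stdEnd F J hJ x = F.toLinearEquiv (D.toCx (J (D.ofCx (F.toLinearEquiv.symm x)))) := by
  change (F.toLinearEquiv.conj (D.cxEnd J hJ)) x = _
  rw [LinearEquiv.conj_apply_apply]
  rfl

/-- **`F J F⁻¹ ∈ X⁺(H₀)` for `J ∈ X⁺`** (transport along the isometry `F`).
[cite: Deligne1982HodgeCycles, proof of Thm. 4.8, p. 49] -/
theorem stdEnd_mem_stdWeilDomain {J : V →L[ℝ] V} (hJ : J ∈ posComplexStructures D.k D.ψ) :
    D.stdEnd F J (D.commute_of_mem hJ) ∈ stdWeilDomain p q := by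
  rw [mem_stdWeilDomain_iff, coe_stdEnd]
  exact ((D.mem_posComplexStructures_iff (D.commute_of_mem hJ)).1 hJ).conj F.toLinearEquiv F.isometry

variable [FiniteDimensional ℝ V]

/-! ### A unitary frame as a real-linear homeomorphism `V ≅ ℂᵖ × ℂ^q` -/

/-- The frame `F : (V, i) ≅ ℂᵖ × ℂ^q` as a continuous REAL-linear isomorphism of `V`.
[cite: vanGeemen1994HodgeAV, 5.4–5.5] -/
def frameℝ : V ≃L[ℝ] (EuclideanSpace ℂ (Fin p) × EuclideanSpace ℂ (Fin q)) :=
  (D.toCxₗ.trans (F.toLinearEquiv.restrictScalars ℝ)).toContinuousLinearEquiv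

/-- `frameℝ F v = F (toCx v)`. [cite: vanGeemen1994HodgeAV, 5.4–5.5] -/
@[simp] theorem frameℝ_apply (v : V) : D.frameℝ F v = F.toLinearEquiv (D.toCx v) := rfl

/-- `(frameℝ F)⁻¹ x = ofCx (F⁻¹ x)`. [cite: vanGeemen1994HodgeAV, 5.4–5.5] -/
@[simp] theorem frameℝ_symm_apply (x : EuclideanSpace ℂ (Fin p) × EuclideanSpace ℂ (Fin q)) :
    (D.frameℝ F).symm x = D.ofCx (F.toLinearEquiv.symm x) := rfl

/-- Conjugation by the frame on real endomorphisms: `J ↦ F_ℝ ∘ J ∘ F_ℝ⁻¹`. [cite: Deligne1982HodgeCycles, proof of Thm. 4.8, p. 49] -/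
def realConj (J : V →L[ℝ] V) :
    (EuclideanSpace ℂ (Fin p) × EuclideanSpace ℂ (Fin q)) →L[ℝ] (EuclideanSpace ℂ (Fin p) × EuclideanSpace ℂ (Fin q)) :=
  ((D.frameℝ F : V →L[ℝ] _).comp J).comp ((D.frameℝ F).symm : _ →L[ℝ] V)

/-- `realConj F J x = F (J (F⁻¹ x))`. [cite: Deligne1982HodgeCycles, proof of Thm. 4.8, p. 49] -/
@[simp] theorem realConj_apply (J : V →L[ℝ] V) (x : EuclideanSpace ℂ (Fin p) × EuclideanSpace ℂ (Fin q)) :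
    D.realConj F J x = F.toLinearEquiv (D.toCx (J (D.ofCx (F.toLinearEquiv.symm x)))) := rfl

/-- `J ↦ F_ℝ ∘ J ∘ F_ℝ⁻¹` is continuous. [cite: Deligne1982HodgeCycles, proof of Thm. 4.8, p. 49] -/
theorem continuous_realConj : Continuous (D.realConj F) :=
  (continuous_const.clm_comp continuous_id).clm_comp continuous_const

/-- The inverse conjugation `J' ↦ F_ℝ⁻¹ ∘ J' ∘ F_ℝ` on real endomorphisms. [cite: Deligne1982HodgeCycles, proof of Thm. 4.8, p. 49] -/
def realConjInv (J' : (EuclideanSpace ℂ (Fin p) × EuclideanSpace ℂ (Fin q)) →L[ℝ]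
    (EuclideanSpace ℂ (Fin p) × EuclideanSpace ℂ (Fin q))) : V →L[ℝ] V :=
  (((D.frameℝ F).symm : _ →L[ℝ] V).comp J').comp (D.frameℝ F : V →L[ℝ] _)

/-- `realConjInv F J' v = F⁻¹ (J' (F v))`. [cite: Deligne1982HodgeCycles, proof of Thm. 4.8, p. 49] -/
@[simp] theorem realConjInv_apply (J' : (EuclideanSpace ℂ (Fin p) × EuclideanSpace ℂ (Fin q)) →L[ℝ]
    (EuclideanSpace ℂ (Fin p) × EuclideanSpace ℂ (Fin q))) (v : V) :
    D.realConjInv F J' v = D.ofCx (F.toLinearEquiv.symm (J' (F.toLinearEquiv (D.toCx v)))) := rfl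

/-- `J' ↦ F_ℝ⁻¹ ∘ J' ∘ F_ℝ` is continuous. [cite: Deligne1982HodgeCycles, proof of Thm. 4.8, p. 49] -/
theorem continuous_realConjInv : Continuous (D.realConjInv F) :=
  (continuous_const.clm_comp continuous_id).clm_comp continuous_const

/-- **`F J F⁻¹` restricted to real scalars is `F_ℝ ∘ J ∘ F_ℝ⁻¹`.** [cite: Deligne1982HodgeCycles, proof of Thm. 4.8, p. 49] -/
theorem restrictScalars_stdEnd (J : V →L[ℝ] V) (hJ : Commute J D.k) :
    (D.stdEnd F J hJ).restrictScalars ℝ = D.realConj F J := by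
  refine ContinuousLinearMap.ext fun x => ?_
  change D.stdEnd F J hJ x = D.realConj F J x
  rw [stdEnd_apply, realConj_apply]

/-- Back: for `J' ∈ X⁺(H₀)`, the real endomorphism `F⁻¹ J' F` of `V`. [cite: Deligne1982HodgeCycles, proof of Thm. 4.8, p. 49] -/
def ofStd (J' : (EuclideanSpace ℂ (Fin p) × EuclideanSpace ℂ (Fin q)) →L[ℂ]
    (EuclideanSpace ℂ (Fin p) × EuclideanSpace ℂ (Fin q))) : V →L[ℝ] V :=
  D.realEnd (F.toLinearEquiv.symm.conj (J' : _ →ₗ[ℂ] _))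

/-- `ofStd F J' = F_ℝ⁻¹ ∘ J' ∘ F_ℝ` as real operators. [cite: Deligne1982HodgeCycles, proof of Thm. 4.8, p. 49] -/
theorem ofStd_eq_realConjInv (J' : (EuclideanSpace ℂ (Fin p) × EuclideanSpace ℂ (Fin q)) →L[ℂ]
    (EuclideanSpace ℂ (Fin p) × EuclideanSpace ℂ (Fin q))) :
    D.ofStd F J' = D.realConjInv F (J'.restrictScalars ℝ) := by
  refine ContinuousLinearMap.ext fun v => ?_
  rw [ofStd, realEnd_apply, LinearEquiv.conj_apply_apply, LinearEquiv.symm_symm, realConjInv_apply]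
  rfl

/-- **`F⁻¹ J' F ∈ X⁺` for `J' ∈ X⁺(H₀)`.** [cite: Deligne1982HodgeCycles, proof of Thm. 4.8, p. 49] -/
theorem ofStd_mem_posComplexStructures
    {J' : (EuclideanSpace ℂ (Fin p) × EuclideanSpace ℂ (Fin q)) →L[ℂ] (EuclideanSpace ℂ (Fin p) × EuclideanSpace ℂ (Fin q))}
    (hJ' : J' ∈ stdWeilDomain p q) : D.ofStd F J' ∈ posComplexStructures D.k D.ψ := by
  have h : IsWeilComplexStructure D.hForm (F.toLinearEquiv.symm.conj (J' : _ →ₗ[ℂ] _)) :=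
    (mem_stdWeilDomain_iff.1 hJ').conj F.toLinearEquiv.symm fun x y => by
      rw [← F.isometry, LinearEquiv.apply_symm_apply, LinearEquiv.apply_symm_apply]
  rw [ofStd, D.mem_posComplexStructures_iff (D.commute_realEnd _), cxEnd_realEnd]
  exact h

/-- `ofStd F (stdEnd F J) = J`. [cite: Deligne1982HodgeCycles, proof of Thm. 4.8, p. 49] -/
theorem ofStd_stdEnd (J : V →L[ℝ] V) (hJ : Commute J D.k) : D.ofStd F (D.stdEnd F J hJ) = J := by
  rw [ofStd, coe_stdEnd]
  have h : F.toLinearEquiv.symm.conj (F.toLinearEquiv.conj (D.cxEnd J hJ)) = D.cxEnd J hJ :=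
    LinearMap.ext fun x => by simp
  rw [h, realEnd_cxEnd]

/-- `stdEnd F (ofStd F J') = J'`. [cite: Deligne1982HodgeCycles, proof of Thm. 4.8, p. 49] -/
theorem stdEnd_ofStd (J' : (EuclideanSpace ℂ (Fin p) × EuclideanSpace ℂ (Fin q)) →L[ℂ]
    (EuclideanSpace ℂ (Fin p) × EuclideanSpace ℂ (Fin q))) :
    D.stdEnd F (D.ofStd F J') (D.commute_realEnd _) = J' := by
  refine ContinuousLinearMap.ext fun x => ?_
  rw [stdEnd_apply, ofStd_eq_realConjInv, realConjInv_apply]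
  simp

/-! ### The homeomorphisms -/

/-- Restriction of scalars `End_ℂ(ℂᵖ × ℂ^q) → End_ℝ(ℂᵖ × ℂ^q)` is a topological embedding (an isometry). [folklore] -/
private theorem isEmbedding_restrictScalars :
    Topology.IsEmbedding fun T : (EuclideanSpace ℂ (Fin p) × EuclideanSpace ℂ (Fin q)) →L[ℂ]
        (EuclideanSpace ℂ (Fin p) × EuclideanSpace ℂ (Fin q)) => T.restrictScalars ℝ :=
  (ContinuousLinearMap.restrictScalarsIsometry ℂ (EuclideanSpace ℂ (Fin p) × EuclideanSpace ℂ (Fin q))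
    (EuclideanSpace ℂ (Fin p) × EuclideanSpace ℂ (Fin q)) ℝ ℝ).isometry.isEmbedding

/-- **`posComplexStructures k ψ ≃ₜ X⁺(H₀)`**: in a unitary frame `F`, `J ↦ F J F⁻¹` is a HOMEOMORPHISM of
Deligne's real period domain (operator-norm topology on `End_ℝ(V)`) onto the Weil domain of the standard
Hermitian space. [cite: Deligne1982HodgeCycles, proof of Thm. 4.8, p. 49] [cite: vanGeemen1994HodgeAV, 5.5–5.10] -/
def posComplexStructuresHomeomorphStd : posComplexStructures D.k D.ψ ≃ₜ stdWeilDomain p q where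
  toFun J := ⟨D.stdEnd F J.1 (D.commute_of_mem J.2), D.stdEnd_mem_stdWeilDomain F J.2⟩
  invFun J' := ⟨D.ofStd F J'.1, D.ofStd_mem_posComplexStructures F J'.2⟩
  left_inv J := Subtype.ext (D.ofStd_stdEnd F J.1 (D.commute_of_mem J.2))
  right_inv J' := Subtype.ext (D.stdEnd_ofStd F J'.1)
  continuous_toFun := by
    refine Continuous.subtype_mk ?_ _
    rw [isEmbedding_restrictScalars.continuous_iff]
    have h : ((fun T : (EuclideanSpace ℂ (Fin p) × EuclideanSpace ℂ (Fin q)) →L[ℂ]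
        (EuclideanSpace ℂ (Fin p) × EuclideanSpace ℂ (Fin q)) => T.restrictScalars ℝ) ∘
        fun J : posComplexStructures D.k D.ψ => D.stdEnd F J.1 (D.commute_of_mem J.2)) =
        fun J => D.realConj F J.1 :=
      funext fun J => D.restrictScalars_stdEnd F J.1 (D.commute_of_mem J.2)
    rw [h]
    exact (D.continuous_realConj F).comp continuous_subtype_val
  continuous_invFun := by
    refine Continuous.subtype_mk ?_ _
    have h : (fun J' : stdWeilDomain p q => D.ofStd F J'.1) =
        fun J' => D.realConjInv F (J'.1.restrictScalars ℝ) := funext fun J' => D.ofStd_eq_realConjInv F J'.1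
    rw [h]
    exact (D.continuous_realConjInv F).comp (isEmbedding_restrictScalars.continuous.comp continuous_subtype_val)

/-- On carriers: `(posComplexStructuresHomeomorphStd F J).1 = F J F⁻¹`. [cite: Deligne1982HodgeCycles, proof of Thm. 4.8, p. 49] -/
@[simp] theorem coe_posComplexStructuresHomeomorphStd_apply (J : posComplexStructures D.k D.ψ) :
    (D.posComplexStructuresHomeomorphStd F J).1 = D.stdEnd F J.1 (D.commute_of_mem J.2) := rfl

/-- … and back: `((posComplexStructuresHomeomorphStd F)⁻¹ J').1 = F⁻¹ J' F`. [cite: Deligne1982HodgeCycles, proof of Thm. 4.8, p. 49] -/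
@[simp] theorem coe_posComplexStructuresHomeomorphStd_symm_apply (J' : stdWeilDomain p q) :
    ((D.posComplexStructuresHomeomorphStd F).symm J').1 = D.ofStd F J'.1 := rfl

/-- **Deligne's real `X⁺` is homeomorphic to the type AIII ball `I_{p,q}`** (`(p, q)` the signature of
`H = ψ(·, i·) + iψ`, read off any unitary frame): `posComplexStructures k ψ ≃ₜ {Z : ℂᵖ →L ℂ^q, ‖Z‖ < 1}`.
[cite: Deligne1982HodgeCycles, proof of Thm. 4.8, p. 49 ("an open connected complex submanifold")]
[cite: CarlsonMullerStachPeters2017, Thm. 16.1.5 (type AIII: "realization as a bounded domain `I_{p,q}`")] -/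
def posComplexStructuresHomeomorph : posComplexStructures D.k D.ψ ≃ₜ unitaryPeriodDomain p q :=
  (D.posComplexStructuresHomeomorphStd F).trans (unitaryPeriodDomainHomeomorph p q).symm

/-- The ball coordinate of `J ∈ X⁺` is the angular operator of `F J F⁻¹`.
[cite: GohbergLancasterRodman2005, §10.1 (angular operator)] -/
@[simp] theorem coe_posComplexStructuresHomeomorph_apply (J : posComplexStructures D.k D.ψ) :
    (D.posComplexStructuresHomeomorph F J).1 = angularOp (D.stdEnd F J.1 (D.commute_of_mem J.2)) := rfl

/-- **`X⁺ ≃ₜ` the open unit ball of `Hom(ℂᵖ, ℂ^q) ≅ ℂ^{pq}`.** [cite: CarlsonMullerStachPeters2017, Thm. 16.1.5 (type AIII)]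
[cite: Deligne1982HodgeCycles, proof of Thm. 4.8, p. 49] -/
def posComplexStructuresHomeomorphBall :
    posComplexStructures D.k D.ψ ≃ₜ Metric.ball (0 : EuclideanSpace ℂ (Fin p) →L[ℂ] EuclideanSpace ℂ (Fin q)) 1 :=
  (D.posComplexStructuresHomeomorph F).trans (Homeomorph.setCongr (unitaryPeriodDomain_eq_ball p q))

/-- **Frame-free form**: for `ψ` non-degenerate, Deligne's `X⁺ = posComplexStructures k ψ` is homeomorphic to the
ball `I_{p,q}` for the signature `(p, q)` of `H`, `p + q = dim_ℂ (V, i) = ½ dim_ℝ V`.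
[cite: Deligne1982HodgeCycles, proof of Thm. 4.8, p. 49] [cite: CarlsonMullerStachPeters2017, Thm. 16.1.5 (type AIII)] -/
theorem exists_homeomorph_unitaryPeriodDomain (hψn : D.ψ.Nondegenerate) :
    ∃ p q : ℕ, p + q = finrank ℂ D.Cx ∧ Nonempty (posComplexStructures D.k D.ψ ≃ₜ unitaryPeriodDomain p q) := by
  obtain ⟨p, q, hpq, ⟨F⟩⟩ := exists_unitaryFrame_of_nondegenerate D.isSymm_hForm (D.separatingLeft_hForm hψn)
  exact ⟨p, q, hpq, ⟨D.posComplexStructuresHomeomorph F⟩⟩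

end RealWeilDatum

end Literature.AlgebraicGeometry.Motives
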